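import Mathlib.NumberTheory.ModularForms.Basic
import Mathlib.NumberTheory.ModularForms.CongruenceSubgroups
import Mathlib.NumberTheory.ModularForms.QExpansion
import Mathlib.RingTheory.IntegralClosure.IsIntegral.Basic
import HarnessLib

/-!
# Katz's q-expansion principle at ALL cusps of `Γ(N)` (divisibility of Fourier coefficients is preserved by `SL₂(ℤ)`)

Topic `Literature/NumberTheory/ModularForms`; namespace `Literature.NumberTheory.ModularForms`. STATEMENT ONLY (a named literature fact,
`def … : Prop`); no proof, no definition of a new object.

## Source and statement

N. M. Katz, *p-adic properties of modular schemes and modular forms*, Modular functions of one variable III (Antwerp 1972), LNM 350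
[Katz1973], Ch. 1: §1.2 (q-expansions at the cusps of the naive level-`n` moduli problem: a level-`n` structure on the Tate curve
`Tate(qⁿ)` is defined over `ℤ[1/n, ζ_n]((q))`, so the q-expansion of a modular form of level `n` with coefficients in a `ℤ[1/n]`-module
`K` at any cusp lies in `K ⊗ ℤ[1/n, ζ_n]⟦q⟧`), §1.6 **the q-expansion principle**, Corollary 1.6.2: for `n ≥ 3`, `K` a `ℤ[1/n]`-module and
`K' ⊂ K` a `ℤ[1/n]`-SUBMODULE, a modular form of weight `k` and level `n`, holomorphic at infinity, with coefficients in `K`, whose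
q-expansion at ONE cusp has all its coefficients in `K'`, is a modular form with coefficients in `K'` — hence (§1.2) its q-expansions at
ALL cusps have coefficients in `K' ⊗ ℤ[1/n, ζ_n]`; §1.7 (base change) with P. Deligne – M. Rapoport, *Les schémas de modules de courbes
elliptiques*, LNM 349 [DeligneRapoport1973], VII §4 (comparison of the algebraic and the analytic theory: holomorphic modular forms
on `Γ(n)` bounded at all cusps = sections of `ω^k` over `ℂ`, the cusps of `Γ(n)\ℍ*` ↔ level-`n` structures on the Tate curve, the
expansion at the cusp `γ·∞` = the analytic q-expansion of `f ∣_k γ` in the parameter `e^{2πiz/n}`).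

Read analytically with `K = ℂ` and `K' = d · ℤ̄[1/N]` (`ℤ̄` = the algebraic integers of `ℂ`; a `ℤ[1/N]`-submodule of `ℂ` containing
`ζ_N · K'`), this gives the statement typed below: **if every coefficient of the q-expansion at `∞` (parameter `e^{2πiz/N}`) of a
holomorphic modular form `f` of weight `k` on `Γ(N)`, `N ≥ 3`, lies in `d · ℤ̄[1/N]`, then for every `γ ∈ SL₂(ℤ)` every coefficient of
the q-expansion of `f ∣_k γ` at `∞` lies in `d · ℤ̄[1/N]`.** Membership `y ∈ ℤ̄[1/N]` is spelled `∃ j, IsIntegral ℤ (N^j · y)`.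
With `d = 1` this is the integrality of the Fourier expansions at all cusps; with `d = p^e`, `p ∤ N`, it is the mod-`p^e` principle
«`f ≡ 0 (mod p^e)` at `∞` ⟹ `f ∣ γ ≡ 0 (mod p^e)` at `∞`» used by consumers that read a constant term at another cusp modulo `p`
(crux `PrintCFram.BottomClassIndexLawFiveLe`, line `eisenstein-resource-bdp-line`, registry v22–v24: the cusp conjunct of
`CuspSeed.cuspSeed_of_cutForm`, cell `bsd-print-cfram`).

## Mathlib currency

`ModularForm (CongruenceSubgroup.Gamma N) k` (Mathlib: `SlashInvariantForm` for the image of `Γ(N)` in `GL(2,ℝ)`, holomorphic,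
bounded at every cusp), `UpperHalfPlane.qExpansion (N : ℝ) f` (the q-expansion in the parameter `𝕢 N z = e^{2πiz/N}`; `N` is a strict
period of `Γ(N)` and of `γ⁻¹Γ(N)γ = Γ(N)`), the weight-`k` slash action `f ∣[k] γ` of `γ : SL(2, ℤ)` on functions `ℍ → ℂ`, and
`IsIntegral ℤ`. No new definition. The special case is faithful to the printed theorem (it is weaker: `K' = dℤ̄[1/N]` only);
`-- TODO(general form): arbitrary ℤ[1/N]-submodules K' ⊂ K and modular forms over ℤ[1/N]-algebras (Katz 1973 Cor. 1.6.2 verbatim)`.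

References: [Katz1973] §1.2, §1.6 Cor. 1.6.2, §1.7; [DeligneRapoport1973] VII §4.
-/

namespace Literature.NumberTheory.ModularForms

open scoped MatrixGroups ModularForm
open UpperHalfPlane PowerSeries

/-- **Katz's q-expansion principle at all cusps of `Γ(N)` (named fact, statement only).** For `N ≥ 3`, a holomorphic modular form `f`
of weight `k` on `Γ(N)` (Mathlib `ModularForm (CongruenceSubgroup.Gamma N) k`) and `d ∈ ℕ`: if every coefficient of the q-expansion of
`f` at `∞` in the parameter `e^{2πiz/N}` lies in `d · ℤ̄[1/N]` (`ℤ̄` = algebraic integers; `y ∈ ℤ̄[1/N]` iff `N^j y` is integral over `ℤ`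
for some `j`), then for every `γ ∈ SL₂(ℤ)` every coefficient of the q-expansion of `f ∣_k γ` at `∞` lies in `d · ℤ̄[1/N]` — Katz's
Corollary 1.6.2 (q-expansion principle for a `ℤ[1/N]`-submodule `K' = dℤ̄[1/N] ⊂ K = ℂ`) with §1.2 (expansions at all cusps of a form
with coefficients in `K'` lie in `K' ⊗ ℤ[1/N, ζ_N]`) read through the algebraic/analytic dictionary (Katz §1.7, Deligne–Rapoport VII §4:
the cusp `γ∞` of `Γ(N)` ↔ a level-`N` structure on the Tate curve, expansion there = analytic expansion of `f ∣_k γ`).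
[cite: Katz1973, §1.6 Cor. 1.6.2, §1.2, §1.7] [cite: DeligneRapoport1973, VII §4] [file NumberTheory/ModularForms/KatzQExpansionPrincipleCusps] -/
def Katz1973_qExpansionPrinciple_allCusps : Prop :=
  ∀ (N : ℕ), 3 ≤ N → ∀ (k : ℤ) (f : ModularForm (CongruenceSubgroup.Gamma N) k) (d : ℕ),
    (∀ n : ℕ, ∃ y : ℂ, (∃ j : ℕ, IsIntegral ℤ ((N : ℂ) ^ j * y)) ∧ coeff n (qExpansion N ⇑f) = (d : ℂ) * y) →
    ∀ (γ : SL(2, ℤ)) (n : ℕ),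
      ∃ y : ℂ, (∃ j : ℕ, IsIntegral ℤ ((N : ℂ) ^ j * y)) ∧ coeff n (qExpansion N (⇑f ∣[k] γ)) = (d : ℂ) * y

-- TODO(general form): Katz 1973 Cor. 1.6.2 for arbitrary `ℤ[1/N]`-submodules `K' ⊂ K` and forms over `ℤ[1/N]`-algebras; the
-- `Γ₁(N)` / `Γ₀(N)`-with-character versions follow by restriction to `Γ(N)`.

end Literature.NumberTheory.ModularForms
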